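import Summits.MatrixMultiplication.MatrixMultiplication.Theorems.GradedDesignFamily.Negative.SubfieldCellNineWallTwenty

/-!
# Subfield cell `GL₂(𝔽₉) ⊃ SL₂(𝔽₃)` at level one — VIII-a: capacity lemmas for row three

**Honest framing.** VALUE = lemmas toward a theorem about ONE finite cell of ONE skeleton line
(`quadratic_extension_level_one_cell`, stub S3 `stub_subfieldCell`, crux `GradedDesignFamily`,
route `LevelGradedCohnUmans`): a decidable verdict on small instances, **not** progress on
`Summit.MatrixMultiplication`, and nothing here bears on the asymptotic stub.

**Contents** (pure linear algebra over the λ-vectors `w_g ∈ ℂ²⁰` of files I/II, no certificates):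
* coordinates of `w_g` from the code `vc g` (`w_eq_zero_of_vc`, `w_ne_zero_of_vc`) and
  `kprop ⇒ w_{g₁} = c • w_{g₂}` with `c ≠ 0` (`w_smul_of_kprop`);
* small independent families (`linIndep_pair`, `linIndep_triple`);
* the **capacity bound** (`capacity`): dual vectors for the `w_z` (`z ∈ Z`), `m` independent
  garbage vectors killed by all duals, and `n` functionals killing everything and independent on
  `n` test vectors force `|Z| + m + n ≤ 20 = dim`;
* conjugation invariance of level-one separation (`IsSep.conj`: `Y ↦ gYg⁻¹`, `Z ↦ gZ`,
  `g ∈ SL₂(𝔽₃)`), the WLOG step that lets file VIII-b assume `y₂y₁⁻¹` is a class representative.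
-/

set_option linter.dupNamespace false

namespace Summit.MatrixMultiplication.MatrixMultiplication.Theorems.GradedDesignFamily.Negative.SubfieldNine

open Matrix Module

/-! ### λ-vectors: coordinates, proportionality, small independent families -/

/-- `2·cval(e+j) = cval j · cval e`. -/
theorem two_mul_cval_add : ∀ e j : ZMod 3, 2 * cval (e + j) = cval j * cval e := by decide

/-- `cval e ≠ 0`. -/
theorem cval_ne_zero : ∀ e : ZMod 3, cval e ≠ 0 := by decide

/-- A vanishing code gives a vanishing coordinate. -/
theorem w_eq_zero_of_vc {g : Mat} {i : Idx} (h : vc g i = none) : w g i = 0 := by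
  simp [w, vz, h, oval]

/-- A non-vanishing code gives a non-vanishing coordinate. -/
theorem w_ne_zero_of_vc {g : Mat} {i : Idx} (h : vc g i ≠ none) : w g i ≠ 0 := by
  obtain ⟨e, he⟩ := Option.ne_none_iff_exists'.mp h
  intro h0
  have : σ (cval e) = σ 0 := by
    rw [map_zero, ← h0]; simp only [w, vz, he, oval]
  exact cval_ne_zero e (σ_injective this)

/-- A cyclic shift of codes is a non-zero complex multiple of λ-vectors. -/
theorem w_smul_of_kprop {g₁ g₂ : Mat} (h : kprop (vc g₁) (vc g₂)) :
    ∃ c : ℂ, c ≠ 0 ∧ w g₁ = c • w g₂ := by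
  obtain ⟨j, hj⟩ := h
  refine ⟨σ (cval j) / 2, div_ne_zero (fun h0 => cval_ne_zero j (σ_injective (by
    rw [h0, map_zero]))) two_ne_zero, funext fun i => ?_⟩
  rw [Pi.smul_apply, smul_eq_mul]
  simp only [w, vz, hj i]
  generalize vc g₂ i = o
  cases o with
  | none => simp [oval]
  | some e =>
    have h2 := congrArg σ (two_mul_cval_add e j)
    rw [map_mul, map_mul, σ_two] at h2
    show σ (cval (e + j)) = σ (cval j) / 2 * σ (cval e)
    linear_combination h2 / 2

/-- Two vectors, the first not a multiple of the (non-zero) second, are independent. -/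
theorem linIndep_pair {p q : Idx → ℂ} (hpq : ∀ c : ℂ, p ≠ c • q) (hq : q ≠ 0) :
    LinearIndependent ℂ ![p, q] := by
  rw [Fintype.linearIndependent_iff]
  intro g hg
  have e0 : ![p, q] 0 = p := rfl
  have e1 : ![p, q] 1 = q := rfl
  simp only [Fin.sum_univ_two, e0, e1] at hg
  by_cases h0 : g 0 = 0
  · rw [h0, zero_smul, zero_add] at hg
    have h1 : g 1 = 0 := (smul_eq_zero.mp hg).resolve_right hq
    intro i
    fin_cases i
    · exact h0
    · exact h1
  · exfalso
    apply hpq (-(g 1) / g 0)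
    funext i
    have hi := congrFun hg i
    simp only [Pi.add_apply, Pi.smul_apply, smul_eq_mul, Pi.zero_apply] at hi
    rw [Pi.smul_apply, smul_eq_mul]
    field_simp
    linear_combination hi

/-- Triangular extension of `linIndep_pair` by a vector supported where `p, q` vanish. -/
theorem linIndep_triple {p q r : Idx → ℂ} (hpq : ∀ c : ℂ, p ≠ c • q) (hq : q ≠ 0) {i : Idx}
    (hr : r i ≠ 0) (hp : p i = 0) (hq0 : q i = 0) : LinearIndependent ℂ ![p, q, r] := by
  rw [Fintype.linearIndependent_iff]
  intro g hg
  have e0 : ![p, q, r] 0 = p := rfl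
  have e1 : ![p, q, r] 1 = q := rfl
  have e2 : ![p, q, r] 2 = r := rfl
  simp only [Fin.sum_univ_three, e0, e1, e2] at hg
  have h2 : g 2 = 0 := by
    have hi := congrFun hg i
    simp only [Pi.add_apply, Pi.smul_apply, smul_eq_mul, Pi.zero_apply, hp, hq0, mul_zero,
      zero_add] at hi
    exact (mul_eq_zero.mp hi).resolve_right hr
  rw [h2, zero_smul, add_zero] at hg
  have h01 := Fintype.linearIndependent_iff.mp (linIndep_pair hpq hq) ![g 0, g 1]
    (by rw [Fin.sum_univ_two]; exact hg)
  intro j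
  fin_cases j
  · exact h01 0
  · exact h01 1
  · exact h2

/-- `⟨e_i, x⟩ = x i`. -/
theorem pairL_single (i : Idx) (x : Idx → ℂ) : pairL (Pi.single i 1) x = x i := by
  rw [pairL_apply]
  simp only [Pi.single_apply, mul_ite, mul_one, mul_zero, Finset.sum_ite_eq',
    Finset.mem_univ, if_true]

/-- `⟨𝟙, e_i⟩ = 1`. -/
theorem pairL_one_single (i : Idx) : pairL (fun _ => 1) (Pi.single i (1 : ℂ)) = 1 := by
  rw [pairL_apply]
  simp only [Pi.single_apply, ite_mul, one_mul, zero_mul, Finset.sum_ite_eq',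
    Finset.mem_univ, if_true]

/-! ### The capacity bound -/

/-- **Capacity.** If the `w_z` (`z ∈ Z`) have dual vectors `E_{z₀}` (`⟨w_z, E_{z₀}⟩ = 4δ`), `m`
independent garbage vectors are killed by every `E_{z₀}`, and `n` functionals kill all of these
and are independent on some `n` test vectors, then `|Z| + m + n ≤ 20`. -/
theorem capacity {Z : Finset (GL (Fin 2) K)} (E : {z // z ∈ Z} → Idx → ℂ)
    (hE : ∀ z₀ z : {z // z ∈ Z}, pairL (E z₀) (w ((z : GL (Fin 2) K) : Mat)) =
      if z = z₀ then 4 else 0)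
    {m : ℕ} (g : Fin m → Idx → ℂ) (hg : LinearIndependent ℂ g)
    (hgE : ∀ z₀ j, pairL (E z₀) (g j) = 0)
    {n : ℕ} (F : Fin n → Idx → ℂ)
    (hFz : ∀ l (z : {z // z ∈ Z}), pairL (F l) (w ((z : GL (Fin 2) K) : Mat)) = 0)
    (hFg : ∀ l j, pairL (F l) (g j) = 0) (e : Fin n → Idx → ℂ)
    (he : LinearIndependent ℂ fun l => (fun l' => pairL (F l') (e l) : Fin n → ℂ)) :
    Z.card + m + n ≤ 20 := by
  classical
  let Zs := {z // z ∈ Z}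
  let fam : Zs ⊕ Fin m → Idx → ℂ := Sum.elim (fun z => w ((z : GL (Fin 2) K) : Mat)) g
  have hfam : LinearIndependent ℂ fam := by
    rw [Fintype.linearIndependent_iff]
    intro c hc
    rw [Fintype.sum_sum_type] at hc
    simp only [fam, Sum.elim_inl, Sum.elim_inr] at hc
    have hz : ∀ z : Zs, c (Sum.inl z) = 0 := by
      intro z₀
      have := congrArg (pairL (E z₀)) hc
      simp only [map_add, map_sum, map_smul, map_zero, smul_eq_mul, hE z₀, hgE z₀, mul_ite,
        mul_zero, Finset.sum_const_zero, add_zero] at this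
      rw [Finset.sum_ite_eq'] at this
      simpa using this
    simp only [hz, zero_smul, Finset.sum_const_zero, zero_add] at hc
    have hg' := Fintype.linearIndependent_iff.mp hg _ hc
    rintro (z | j)
    exacts [hz z, hg' j]
  let f : (Idx → ℂ) →ₗ[ℂ] (Fin n → ℂ) := LinearMap.pi fun l => pairL (F l)
  have hind := linIndep_sum_elim f fam e hfam
    (by
      rintro (z | j) <;> funext l
      · simp only [f, LinearMap.pi_apply, fam, Sum.elim_inl, hFz, Pi.zero_apply]
      · simp only [f, LinearMap.pi_apply, fam, Sum.elim_inr, hFg, Pi.zero_apply])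
    he
  have := hind.fintype_card_le_finrank
  rw [finrank_V, Fintype.card_sum, Fintype.card_sum, Fintype.card_coe, Fintype.card_fin,
    Fintype.card_fin] at this
  exact this

/-! ### Conjugation -/

/-- Conjugation `Y ↦ gYg⁻¹`, `Z ↦ gZ` by `g ∈ SL₂(𝔽₃)` preserves separation (`cf'(u,v) = cf(u, g⁻¹v)`). -/
theorem IsSep.conj {Y Z : Finset (GL (Fin 2) K)} (h : IsSep Y Z) (g : SL3) :
    IsSep (Y.image fun y => SpecialLinearGroup.mapGL K g * y * (SpecialLinearGroup.mapGL K g)⁻¹)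
      (Z.image fun z => SpecialLinearGroup.mapGL K g * z) := by
  intro z₀' hz₀'
  obtain ⟨z₀, hz₀, rfl⟩ := Finset.mem_image.mp hz₀'
  obtain ⟨cf, hcf⟩ := h z₀ hz₀
  refine ⟨fun u v => cf u ((((SpecialLinearGroup.mapGL K g)⁻¹ : GL (Fin 2) K) : Mat) *ᵥ v), ?_⟩
  intro a y' hy' y'' hy'' z' hz'
  obtain ⟨y, hy, rfl⟩ := Finset.mem_image.mp hy'
  obtain ⟨yy, hyy, rfl⟩ := Finset.mem_image.mp hy''
  obtain ⟨z, hz, rfl⟩ := Finset.mem_image.mp hz'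
  have key : SpecialLinearGroup.mapGL K a * (SpecialLinearGroup.mapGL K g * y *
      (SpecialLinearGroup.mapGL K g)⁻¹) * (SpecialLinearGroup.mapGL K g * yy *
      (SpecialLinearGroup.mapGL K g)⁻¹)⁻¹ * (SpecialLinearGroup.mapGL K g * z) =
      SpecialLinearGroup.mapGL K g * (SpecialLinearGroup.mapGL K (g⁻¹ * a * g) * y * yy⁻¹ * z) := by
    rw [map_mul, map_mul, map_inv]; group
  rw [key]
  simp only [Matrix.mulVec_mulVec, ← Units.val_mul, inv_mul_cancel_left]
  rw [hcf (g⁻¹ * a * g) y hy yy hyy z hz]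
  have hconj : (g⁻¹ * a * g = 1) ↔ a = 1 := by
    constructor
    · intro h1
      calc a = g * (g⁻¹ * a * g) * g⁻¹ := by group
        _ = 1 := by rw [h1]; group
    · rintro rfl; group
  have h2 : (SpecialLinearGroup.mapGL K g * y * (SpecialLinearGroup.mapGL K g)⁻¹ =
      SpecialLinearGroup.mapGL K g * yy * (SpecialLinearGroup.mapGL K g)⁻¹) ↔ y = yy := by
    rw [mul_left_inj, mul_right_inj]
  have h3 : (SpecialLinearGroup.mapGL K g * z = SpecialLinearGroup.mapGL K g * z₀) ↔ z = z₀ :=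
    mul_right_inj _
  simp only [hconj, h2, h3]

end Summit.MatrixMultiplication.MatrixMultiplication.Theorems.GradedDesignFamily.Negative.SubfieldNine
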